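import Literature.Barriers.CriticalPhenomena.LaceExpansionCubeIBP
import Literature.Barriers.CriticalPhenomena.LaceExpansionKernelDerivatives
import HarnessLib

/-!
# The character-tested derivative identity on the cube:
# `∫_{[-π,π]^d} e^{ik·x} ∂_l^n φ(k) dk = (-i x_l)^n ∫_{[-π,π]^d} e^{ik·x} φ(k) dk`

Barrier catalogue `Literature/Barriers/CriticalPhenomena/` (D-0021), infrastructure for the proof
of the named fact `SpreadOutIsing.LiuSlade2026_thm22` (Liu–Slade 2026, Theorem 2.2) through its
cube-side reduction `LiuSlade2026_thm22_of_prop32_cube`, whose hypothesis asks, for each axis `l`,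
for an integrable `w_l` with `∫ e^{ik·x} w_l = (-i x_l)^{n_d} ∫ e^{ik·x} f̂_z` — the identity that
`n_d` integrations by parts in `k_l` produce (Liu–Slade 2024, proof of Lemma 2.3: "the proof … only
uses integration by parts"). This file PROVES that identity for a smooth, `2π`-periodic-in-`k_l`
symbol `φ` on `ℝ^d` (the regularised `f̂` of the sequel), by iterating the tree's one-coordinate
periodic integration by parts `integral_cube_mul_deriv_eq_neg` against the character
`U(k) = e^{ik·x}`, `x ∈ ℤ^d` (`∂_l U = i x_l U`, and `U` is `2π`-periodic in `k_l` because
`x_l ∈ ℤ`):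

* `hasDerivAt_cexp_kdot_slice`, `cexp_kdot_update_neg_pi` — the character along a slice
  (through the tree's `kdot_update`; its continuity is the tree's `continuous_cexp_I_mul_kdot`);
* `integral_cube_cexp_mul_slice_deriv` — one step: `∫ e^{ik·x} ∂_l g = -(i x_l) ∫ e^{ik·x} g`;
* `integral_cube_cexp_mul_iterate_slice_deriv` — **`n` steps**: for a family `g 0, …, g n` with
  `g (m+1)` the slice derivative of `g m` in `k_l`, all continuous and `2π`-periodic in `k_l`,
  `∫ e^{ik·x} g n = (-(i x_l))^n ∫ e^{ik·x} g 0`.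

## References

* Y. Liu, G. Slade, *Gaussian deconvolution and the lace expansion for spread-out models*,
  Ann. Inst. H. Poincaré Probab. Statist. 62 (2026), arXiv:2310.07640: Lemma 3.1 and its use in
  the proof of Theorem 2.2 [LiuSlade2026].
* Y. Liu, G. Slade, *Gaussian deconvolution and the lace expansion*, Probab. Theory Related
  Fields 195 (2024), arXiv:2310.07635: Lemma 2.3 and its proof (integration by parts against the
  characters) [LiuSlade2024].
-/

noncomputable section

namespace Literature.Barriers.CriticalPhenomena

open MeasureTheory Filter Finset Literature.Probability.LatticeModels
open scoped Topology BigOperators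

variable {d : ℕ}

/-! ## The character `e^{ik·x}` along a coordinate slice -/

/-- **`∂_l e^{ik·x} = i x_l e^{ik·x}`** along the slice `s ↦ k[l↦s]`. [folklore] -/
theorem hasDerivAt_cexp_kdot_slice (x : Site d) (l : Fin d) (k : Fin d → ℝ) :
    HasDerivAt (fun s => Complex.exp (Complex.I * (kdot (Function.update k l s) x : ℂ)))
      (Complex.I * (x l : ℂ) * Complex.exp (Complex.I * (kdot k x : ℂ))) (k l) := by
  have haff : ∀ s, (kdot (Function.update k l s) x : ℂ) =
      (s : ℂ) * (x l : ℂ) + ((kdot k x - k l * (x l : ℝ) : ℝ) : ℂ) := fun s => by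
    rw [kdot_update]; push_cast; ring
  simp_rw [haff]
  have h1 : HasDerivAt (fun s : ℝ => Complex.I * ((s : ℂ) * (x l : ℂ) + ((kdot k x - k l * (x l : ℝ) : ℝ) : ℂ)))
      (Complex.I * (1 * (x l : ℂ))) (k l) := by
    refine HasDerivAt.const_mul _ ?_
    refine (HasDerivAt.mul_const ?_ _).add_const _
    exact Complex.ofRealCLM.hasDerivAt
  have h2 := h1.cexp
  have hback : Complex.I * (((k l : ℝ) : ℂ) * (x l : ℂ) + ((kdot k x - k l * (x l : ℝ) : ℝ) : ℂ)) =
      Complex.I * (kdot k x : ℂ) := by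
    congr 1; push_cast; ring
  rw [hback] at h2
  convert h2 using 1
  ring

/-- **The character is `2π`-periodic in each `k_l`** (`x_l ∈ ℤ`): `e^{i k[l↦-π]·x} = e^{i k[l↦π]·x}`.
[folklore] -/
theorem cexp_kdot_update_neg_pi (x : Site d) (l : Fin d) (k : Fin d → ℝ) :
    Complex.exp (Complex.I * (kdot (Function.update k l (-Real.pi)) x : ℂ)) =
      Complex.exp (Complex.I * (kdot (Function.update k l Real.pi) x : ℂ)) := by
  rw [kdot_update, kdot_update]
  push_cast
  have h : Complex.I * ((kdot k x : ℂ) + (-(Real.pi : ℂ) - (k l : ℂ)) * (x l : ℂ)) =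
      Complex.I * ((kdot k x : ℂ) + ((Real.pi : ℂ) - (k l : ℂ)) * (x l : ℂ)) +
        (-(x l) : ℤ) * (2 * Real.pi * Complex.I) := by
    push_cast; ring
  rw [h, Complex.exp_add, Complex.exp_int_mul_two_pi_mul_I, mul_one]

/-! ## One and `n` integrations by parts against the character -/

/-- **One integration by parts against the character**: if `g'` is the slice derivative of `g` in
`k_l` (everywhere), both are continuous and `g` is `2π`-periodic in `k_l`, then
`∫_{[-π,π]^d} e^{ik·x} g'(k) dk = -(i x_l) ∫_{[-π,π]^d} e^{ik·x} g(k) dk`.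
[cite: LiuSlade2024, Lemma 2.3, proof (integration by parts)] -/
theorem integral_cube_cexp_mul_slice_deriv (x : Site d) (l : Fin d) {g g' : (Fin d → ℝ) → ℂ}
    (hg : ∀ k, HasDerivAt (fun s => g (Function.update k l s)) (g' k) (k l))
    (hgc : Continuous g) (hg'c : Continuous g')
    (hper : ∀ k, g (Function.update k l (-Real.pi)) = g (Function.update k l Real.pi)) :
    ∫ k in cube d, Complex.exp (Complex.I * (kdot k x : ℂ)) * g' k =
      -(Complex.I * (x l : ℂ)) * ∫ k in cube d, Complex.exp (Complex.I * (kdot k x : ℂ)) * g k := by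
  have h := integral_cube_mul_deriv_eq_neg l
    (U := fun k => Complex.exp (Complex.I * (kdot k x : ℂ)))
    (U' := fun k => Complex.I * (x l : ℂ) * Complex.exp (Complex.I * (kdot k x : ℂ)))
    (G := g) (G' := g') (fun k => hasDerivAt_cexp_kdot_slice x l k) hg (continuous_cexp_I_mul_kdot x)
    (continuous_const.mul (continuous_cexp_I_mul_kdot x)) hgc hg'c
    (fun k => by rw [cexp_kdot_update_neg_pi, hper])
  rw [h, ← integral_neg, ← integral_const_mul]
  refine setIntegral_congr_fun (measurableSet_cube d) fun k _ => ?_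
  ring

/-- **`n` integrations by parts against the character**: for a family `g 0, g 1, …` in which
`g (m+1)` is the slice derivative of `g m` in `k_l` (everywhere on `ℝ^d`) for `m < n`, all `g m`
continuous (`m ≤ n`) and `2π`-periodic in `k_l` (`m < n`),
`∫_{[-π,π]^d} e^{ik·x} g n = (-(i x_l))^n ∫_{[-π,π]^d} e^{ik·x} g 0` for every `x ∈ ℤ^d`.
[cite: LiuSlade2026, Lemma 3.1 with (3.7)] [cite: LiuSlade2024, Lemma 2.3, proof (integration by parts)] -/
theorem integral_cube_cexp_mul_iterate_slice_deriv (x : Site d) (l : Fin d) (n : ℕ)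
    {g : ℕ → (Fin d → ℝ) → ℂ}
    (hg : ∀ m < n, ∀ k, HasDerivAt (fun s => g m (Function.update k l s)) (g (m + 1) k) (k l))
    (hgc : ∀ m ≤ n, Continuous (g m))
    (hper : ∀ m < n, ∀ k, g m (Function.update k l (-Real.pi)) = g m (Function.update k l Real.pi)) :
    ∫ k in cube d, Complex.exp (Complex.I * (kdot k x : ℂ)) * g n k =
      (-(Complex.I * (x l : ℂ))) ^ n * ∫ k in cube d, Complex.exp (Complex.I * (kdot k x : ℂ)) * g 0 k := by
  induction n with
  | zero => simp
  | succ n ih =>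
    rw [integral_cube_cexp_mul_slice_deriv x l (hg n (Nat.lt_succ_self n)) (hgc n (Nat.le_succ n))
      (hgc (n + 1) le_rfl) (hper n (Nat.lt_succ_self n)),
      ih (fun m hm => hg m (Nat.lt_succ_of_lt hm)) (fun m hm => hgc m (Nat.le_succ_of_le hm))
        (fun m hm => hper m (Nat.lt_succ_of_lt hm)), pow_succ]
    ring

end Literature.Barriers.CriticalPhenomena

end
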